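import Literature.MathematicalPhysics.QuantumLattice.MagneticHubbardTorusGauge
import Literature.MathematicalPhysics.QuantumLattice.HubbardBondAlgebra
import HarnessLib

/-!
# The column gauge lemma: a seam twist is a pure gauge on every coupling pattern that misses a
# column of the torus (pub-hubbard BOUNDS, Theorem 12, Lemma 12.5 — KERNEL-PROVED)

HONEST FRAMING: ladder R1–R4 with certified numbers; no claim on H/H₀. These are rigorous
statements about a MODEL CLASS (on-site Hubbard-type Hamiltonians on the `L × L` torus with
arbitrary complex bond couplings), no materials claim.

Cell tree `Summits/HubbardSuperconductivity/HubbardLadder/Bounds/` (programme-internal statements;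
nothing here is a cited Literature fact). bounds.tex §12, Lemma 12.5 (bounds g23, 2026-08-21).

The one genuinely new step of bounds.tex Theorem 12 ("no stiffness above `T*`") is the COLUMN
LEMMA: in Ueltschi's generalised Gibbs factor `Zc(β,U,μ;c) = Tr exp(-β V_Λ + Σ_b c_b T_b)`
(`Literature…HubbardBondAlgebra`, the object the tree's polymer representation of the Hubbard
partition function is built from), multiplying the couplings by the seam phases `e^{±iθ}` of the
twisted boundary condition (`seamTwist`, `diagSeamTwist`: every hopping INTO column `0` FROM column
`L-1` carries `e^{iθ}`, its adjoint `e^{-iθ}`) does NOT change `Zc` as soon as the coupling pattern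
`c` avoids one column `k` of the torus and only joins equal or cyclically adjacent columns (as the
nearest- and next-nearest-neighbour bonds of the `t–t'` torus do, `L ≥ 3`). Reason: on the arc
`(ℤ/L) ∖ {k}` the seam cocycle is the coboundary of `x ↦ θ·[k < x₁]`, and the site-phase
transformation `phaseGauge` (Koma–Tasaki) with that phase is unitary, fixes every on-site term
(`[v_x, n_x] = 0`) and multiplies `T_{(x,y,σ)} = c†_{xσ} c_{yσ}` by `g_x conj g_y`. Consequently
(bounds.tex Lemma 12.5 ⇒ proof of Thm 12(i)) every polymer activity supported on a column-missing
set is twist-blind, and only clusters of total size `≥ L` see the twist.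

Proved here (0 sorry):
* `phaseGauge_mul_bondOp_mul_conjTranspose`, `phaseGauge_mul_hopSum_mul_conjTranspose`,
  `phaseGauge_mul_onSiteOp_mul_conjTranspose`, `phaseGauge_mul_onSiteSum_mul_conjTranspose` —
  gauge covariance of Ueltschi's bond algebra (any finite `Λ`);
* `Zc_gauge` — `Zc(β,U,μ; g_x conj g_y · c) = Zc(β,U,μ; c)` for every `g : Λ → U(1)` (any finite `Λ`,
  complex `β, U, μ`, arbitrary complex couplings);
* `columnGauge_coboundary` — the combinatorial core on the `L × L` torus, `L ≥ 3`;
* the node `ColumnGaugeTwistBlindness` (`@[conjecture] def`, the cell's typed statement of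
  Lemma 12.5 for arbitrary coupling patterns) and its proof `columnGaugeTwistBlindness_holds`.

References: D. Ueltschi, J. Stat. Phys. 95 (1999) 693 (arXiv:cond-mat/9810320) §2.3 (the bond
algebra and `Zc`); T. Koma, H. Tasaki, PRL 68 (1992) 3248, eqs. (5)–(8) (site gauge); N. Byers,
C. N. Yang, PRL 7 (1961) 46 (flux as a boundary gauge); bounds.tex §12 Lemma 12.5.
-/

noncomputable section

namespace Summit.HubbardSuperconductivity.HubbardLadder.Bounds

open Matrix Literature.MathematicalPhysics.QuantumLattice
open scoped ComplexConjugate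

/-! ### Gauge covariance of Ueltschi's bond algebra (any finite `Λ`) -/

section Gauge

variable {Λ : Type*} [LinearOrder Λ] [Fintype Λ]

/-- `W_g T_{(x,y,σ)} W_gᴴ = (g_x conj g_y) T_{(x,y,σ)}` for `T_{(x,y,σ)} = c†_{xσ} c_{yσ}`. -/
theorem phaseGauge_mul_bondOp_mul_conjTranspose (g : Λ → Circle) (b : Bond Λ) :
    phaseGauge g * bondOp b * (phaseGauge g)ᴴ = ((g b.1 : ℂ) * conj (g b.2.1 : ℂ)) • bondOp b := by
  rw [bondOp, phaseGauge_mul_mul_mul_conjTranspose, phaseGauge_mul_creation_mul_conjTranspose,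
    phaseGauge_mul_annihilation_mul_conjTranspose, Matrix.smul_mul, Matrix.mul_smul, smul_smul]

/-- `W_g (Σ_b c_b T_b) W_gᴴ = Σ_b (g_{b₁} conj g_{b₂} c_b) T_b`: the gauge acts on the couplings by the
`U(1)` coboundary. -/
theorem phaseGauge_mul_hopSum_mul_conjTranspose (g : Λ → Circle) (c : Bond Λ → ℂ) :
    phaseGauge g * hopSum c * (phaseGauge g)ᴴ =
      hopSum fun b => (g b.1 : ℂ) * conj (g b.2.1 : ℂ) * c b := by
  simp only [hopSum, Finset.mul_sum, Finset.sum_mul, Matrix.mul_smul, Matrix.smul_mul,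
    phaseGauge_mul_bondOp_mul_conjTranspose, smul_smul]
  refine Finset.sum_congr rfl fun b _ => ?_
  rw [mul_comm (c b)]

/-- The on-site term `U n_{x↑} n_{x↓} - μ (n_{x↑} + n_{x↓})` is gauge invariant. -/
theorem phaseGauge_mul_onSiteOp_mul_conjTranspose (g : Λ → Circle) (U μ : ℂ) (x : Λ) :
    phaseGauge g * onSiteOp U μ x * (phaseGauge g)ᴴ = onSiteOp U μ x := by
  rw [onSiteOp, Matrix.mul_sub, Matrix.sub_mul, Matrix.mul_smul, Matrix.smul_mul, Matrix.mul_smul,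
    Matrix.smul_mul, Matrix.mul_add, Matrix.add_mul, phaseGauge_mul_mul_mul_conjTranspose]
  simp only [phaseGauge_mul_numberOp_mul_conjTranspose]

/-- `V_A = Σ_{x ∈ A} V_x` is gauge invariant. -/
theorem phaseGauge_mul_onSiteSum_mul_conjTranspose (g : Λ → Circle) (U μ : ℂ) (A : Finset Λ) :
    phaseGauge g * onSiteSum U μ A * (phaseGauge g)ᴴ = onSiteSum U μ A := by
  simp only [onSiteSum, Finset.mul_sum, Finset.sum_mul, phaseGauge_mul_onSiteOp_mul_conjTranspose]

/-- **Gauge invariance of Ueltschi's generalised Gibbs factor**: for every site phase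
`g : Λ → U(1)`, `Zc(β,U,μ; b ↦ g_{b₁} conj g_{b₂} c_b) = Zc(β,U,μ; c)` (complex `β, U, μ`, arbitrary
complex couplings `c`). -/
theorem Zc_gauge (g : Λ → Circle) (β U μ : ℂ) (c : Bond Λ → ℂ) :
    Zc β U μ (fun b => (g b.1 : ℂ) * conj (g b.2.1 : ℂ) * c b) = Zc β U μ c := by
  set W := phaseGauge g with hW
  have hmul : W * Wᴴ = 1 := phaseGauge_mul_conjTranspose_self g
  have hmul' : Wᴴ * W = 1 := conjTranspose_phaseGauge_mul_self g
  have hinv : W⁻¹ = Wᴴ := Matrix.inv_eq_right_inv hmul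
  have hunit : IsUnit W := (Matrix.isUnit_iff_isUnit_det W).mpr
    (Matrix.isUnit_det_of_right_inverse hmul)
  have hX : -(β • onSiteSum U μ (Finset.univ : Finset Λ)) +
      hopSum (fun b => (g b.1 : ℂ) * conj (g b.2.1 : ℂ) * c b) =
      W * (-(β • onSiteSum U μ (Finset.univ : Finset Λ)) + hopSum c) * W⁻¹ := by
    rw [hinv, Matrix.mul_add, Matrix.add_mul, Matrix.mul_neg, Matrix.neg_mul, Matrix.mul_smul,
      Matrix.smul_mul, hW, phaseGauge_mul_onSiteSum_mul_conjTranspose,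
      phaseGauge_mul_hopSum_mul_conjTranspose]
  rw [Zc, Zc, hX, Matrix.exp_conj _ _ hunit, Matrix.trace_mul_cycle, hinv, hmul', Matrix.one_mul]

end Gauge

/-! ### The column gauge on the `L × L` torus -/

section Torus

variable {L : ℕ}

/-- The column index `x₁ ∈ {0, …, L-1}` of a site of the fermionic torus `(ℤ/L)²`. -/
def col (u : FermionTorus 2 L) : ℕ := ((ofLex u) 0 : ℕ)

/-- Auxiliary lemma `col_lt` (support step for the results of this file; see the module docstring). -/
theorem col_lt (u : FermionTorus 2 L) : col u < L := ((ofLex u) 0).isLt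

variable (L) in
/-- The seam phase of the oriented pair `(u, v)` (the bond operator `c†_{uσ} c_{vσ}` moves an
electron from `v` to `u`): `e^{iθ}` if `u₁ = 0` and `v₁ = L-1` (a hop across the seam into column `0`,
as in `seamTwist` / `diagSeamTwist`), `e^{-iθ}` for the reversed pair, `1` otherwise. -/
def seamPhase (θ : ℝ) (u v : FermionTorus 2 L) : ℂ :=
  if col u = 0 ∧ col v = L - 1 then Complex.exp (θ * Complex.I)
  else if col u = L - 1 ∧ col v = 0 then Complex.exp (-(θ * Complex.I)) else 1

/-- The column gauge for the missing column `k`: phase `e^{iθ}` on the columns strictly after `k`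
(up to the seam), `1` before. -/
def columnGauge (θ : ℝ) (k : ℕ) (u : FermionTorus 2 L) : Circle :=
  if k < col u then Circle.exp θ else 1

/-- **The combinatorial column lemma.** On the torus with `L ≥ 3` columns, if `u` and `v` avoid
column `k` and lie in equal or cyclically adjacent columns, the column gauge exactly absorbs the
seam phase: `g_u conj g_v · ω_θ(u,v) = 1`. -/
theorem columnGauge_coboundary (hL : 3 ≤ L) (θ : ℝ) {k : ℕ} (hk : k < L) {u v : FermionTorus 2 L}
    (hu : col u ≠ k) (hv : col v ≠ k)
    (hadj : col u = col v ∨ col u = col v + 1 ∨ col v = col u + 1 ∨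
      (col u = 0 ∧ col v = L - 1) ∨ (col u = L - 1 ∧ col v = 0)) :
    (columnGauge θ k u : ℂ) * conj (columnGauge θ k v : ℂ) * seamPhase L θ u v = 1 := by
  have hcu := col_lt u
  have hcv := col_lt v
  -- `conj e^{iθ} = e^{-iθ}` (folklore; kept local — the tree holds namespace-local copies)
  have hconj : conj (Complex.exp (θ * Complex.I)) = Complex.exp (-(θ * Complex.I)) := by
    rw [← Complex.exp_conj, map_mul, Complex.conj_ofReal, Complex.conj_I, mul_neg]
  unfold columnGauge seamPhase
  split_ifs <;>
    first
    | omega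
    | (simp only [Circle.coe_exp, Circle.coe_one, map_one, hconj, mul_one, one_mul,
        ← Complex.exp_add, add_neg_cancel, neg_add_cancel, Complex.exp_zero])

/-- **Typed statement of bounds.tex Lemma 12.5 (column gauge lemma) for arbitrary coupling
patterns.** For `L ≥ 3`, every twist `θ`, every column `k < L`, all complex `β, U, μ` and every
coupling `c` on the bonds `(u,v,σ)` of the fermionic `L × L` torus whose support avoids column `k`
and joins only equal or cyclically adjacent columns, twisting the couplings by the seam phases does
not change Ueltschi's generalised Gibbs factor: `Zc(β,U,μ; ω_θ · c) = Zc(β,U,μ; c)`. -/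
@[conjecture]
def ColumnGaugeTwistBlindness : Prop :=
  ∀ (L : ℕ), 3 ≤ L → ∀ (θ : ℝ) (k : ℕ), k < L → ∀ (β U μ : ℂ) (c : Bond (FermionTorus 2 L) → ℂ),
    (∀ b, c b ≠ 0 → col b.1 ≠ k ∧ col b.2.1 ≠ k ∧
      (col b.1 = col b.2.1 ∨ col b.1 = col b.2.1 + 1 ∨ col b.2.1 = col b.1 + 1 ∨
        (col b.1 = 0 ∧ col b.2.1 = L - 1) ∨ (col b.1 = L - 1 ∧ col b.2.1 = 0))) →
    Zc β U μ (fun b => seamPhase L θ b.1 b.2.1 * c b) = Zc β U μ c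

/-- **Proof of the column gauge lemma** (bounds.tex Lemma 12.5): gauge away the seam phases with
`columnGauge θ k` (`Zc_gauge` + `columnGauge_coboundary`). -/
theorem columnGaugeTwistBlindness_holds : ColumnGaugeTwistBlindness := by
  intro L hL θ k hk β U μ c hc
  have key : (fun b : Bond (FermionTorus 2 L) =>
      (columnGauge θ k b.1 : ℂ) * conj (columnGauge θ k b.2.1 : ℂ) *
        (seamPhase L θ b.1 b.2.1 * c b)) = c := by
    funext b
    by_cases h0 : c b = 0
    · simp [h0]
    · obtain ⟨hu, hv, hadj⟩ := hc b h0
      rw [← mul_assoc, columnGauge_coboundary hL θ hk hu hv hadj, one_mul]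
  calc Zc β U μ (fun b => seamPhase L θ b.1 b.2.1 * c b)
      = Zc β U μ (fun b : Bond (FermionTorus 2 L) =>
          (columnGauge θ k b.1 : ℂ) * conj (columnGauge θ k b.2.1 : ℂ) *
            (seamPhase L θ b.1 b.2.1 * c b)) := (Zc_gauge _ _ _ _ _).symm
    _ = Zc β U μ c := by rw [key]

end Torus

end Summit.HubbardSuperconductivity.HubbardLadder.Bounds

end
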